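import Literature.Geometry.Lorentzian.KerrFramedCompactness
import Literature.Geometry.Lorentzian.TimeTranslateOmegaLimit
import HarnessLib

/-!
# ω-limits along time translations of an eternally Kerr-close chart, through the horizon

Let `Φ : Kerr.region a r₀ → 𝓢` (`r₀ > 0`: any inner radius off the ring, e.g. inside the event
horizon) be ONE smooth injective chart of a Ricci-flat spacetime that is uniformly close to Kerr on the
whole (time-invariant) chart domain — Kerr deviation `‖Φ^*g − g_{M,a}‖ ≤ θ/(1 + 2|M|/r₀)²`, `θ < 1`,
and bounded in every `Cᵏ` — with `dΦ(A⁻¹∂₀)` future-directed at one point (`A` the Kerr–Schild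
frame). Since the Kerr–Schild components, the frame and the domain are invariant under
`t* ↦ t* + s` (`Kerr.bilin_add_smul_basisVector_zero`, `Kerr.ksFrameInvMap_add_smul_basisVector_zero`),
the time translates `Φ ∘ T_{tₙ}` are again Kerr-pinched with the same bounds
(`Spacetime.deviationExtend_comp_timeShift`), so the framed compactness theorem near Kerr
(`Spacetime.exists_nearKerrChart_subconvergesLocallyTo_isRicciFlat`) applies to them:

**Theorem (`Spacetime.exists_kerrOmegaLimit_timeTranslates`).** For every sequence of times `tₙ`
a subsequence of the pointed spacetimes `(𝓢, Φ(x₀ + tₙ∂₀))` converges in the pointed `Cᵏ_loc`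
sense, for every `k`, to a VACUUM near-framed chart spacetime on the whole region `Kerr.region a r₀`
(through the horizon), whose components are `(1 + 2|M|/r₀)²θ`-close to `g_{M,a}`; the components
of the translated charts converge to it in every `Cᵏ_loc`. This is the honest "late-time limit
near the black hole" object (an ω-limit), with no decay hypothesis.

## References
* P. Petersen, *Riemannian Geometry*, 2nd ed., 2006, Ch. 10 §3.2. [Petersen2006]
* M. T. Anderson, Cheeger–Gromov theory and applications to general relativity, 2004, §5. [Anderson2004]
* R. P. Kerr, A. Schild, 1965, §2–3. [KerrSchild1965]
-/

noncomputable section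

open Set Filter TopologicalSpace Bundle Function
open scoped Manifold ContDiff Topology ENNReal

universe u

set_option maxSynthPendingDepth 3

namespace Literature.Geometry.Lorentzian

namespace Kerr

/-- The inverse Kerr–Schild frame is invariant under `t*`-translations. [cite: KerrSchild1965, §2] -/
theorem ksFrameInvMap_add_smul_basisVector_zero (M a : ℝ) (x : E4) (t : ℝ) :
    ksFrameInvMap M a (x + t • E4.basisVector 0) = ksFrameInvMap M a x := by
  refine ContinuousLinearMap.ext fun v ↦ ?_
  rw [ksFrameInvMap_apply, ksFrameInvMap_apply, scalarH_add_smul_basisVector_zero,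
    nullCovector_add_smul_basisVector_zero, nullVector_add_smul_basisVector_zero]

/-- The chart domain of `Kerr.regionBackground M a r₀` is invariant under time translations
(`r` does not depend on `t*`). [cite: arXiv08110354, §5.1] -/
theorem regionBackground_timeInvariant (M a r₀ : ℝ) :
    ∀ (s : ℝ), ∀ x ∈ ((regionBackground M a r₀).domain : Set E4),
      x + s • E4.basisVector 0 ∈ ((regionBackground M a r₀).domain : Set E4) := by
  intro s x hx
  show x + s • E4.basisVector 0 ∈ (region a r₀ : Set E4)
  rw [SetLike.mem_coe, mem_region, radius_add_time_smul_basisVector]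
  exact hx

/-- The reference form of `Kerr.regionBackground` is invariant under time translations.
[cite: KerrSchild1965, §2] -/
theorem regionBackground_bilin_timeInvariant (M a r₀ : ℝ) :
    ∀ (s : ℝ), ∀ y ∈ ((regionBackground M a r₀).domain : Set E4),
      (regionBackground M a r₀).bilin (y + s • E4.basisVector 0) = (regionBackground M a r₀).bilin y :=
  fun s y _ ↦ bilin_add_smul_basisVector_zero M a y s

end Kerr

namespace Spacetime

variable (𝓢 : Spacetime.{u} 4) {M a r₀ : ℝ}

/-- **ω-limits along time translations of an eternally Kerr-close vacuum chart exist, through the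
horizon** (module docstring). [cite: Petersen2006, Ch. 10 §3.2] -/
theorem exists_kerrOmegaLimit_timeTranslates (hr₀ : 0 < r₀)
    (Φ : Kerr.region a r₀ → 𝓢.carrier) (hΦ : ContMDiff 𝓘(ℝ, E4) (𝓡 4) ∞ Φ) (hinj : Injective Φ)
    {x₀ : E4} (hx₀ : x₀ ∈ (Kerr.region a r₀ : Set E4))
    (hfut : 𝓢.timeOrientation.IsFutureDirected
      (mfderiv 𝓘(ℝ, E4) (𝓡 4) Φ ⟨x₀, hx₀⟩ ((Kerr.ksFrame M a r₀).Ainv x₀ (E4.basisVector 0))))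
    {θ : ℝ} (hθ : θ < 1)
    (hpinch : ∀ y ∈ (Kerr.region a r₀ : Set E4),
      ‖𝓢.deviationExtend (Kerr.regionBackground M a r₀) Φ y‖ ≤ θ / (1 + 2 * |M| / r₀) ^ 2)
    (hbound : ∀ k : ℕ, ∃ Λ : ℝ≥0∞, Λ ≠ ⊤ ∧
      supCkENorm (Kerr.region a r₀ : Set E4) k (𝓢.deviationExtend (Kerr.regionBackground M a r₀) Φ) ≤ Λ)
    (hvac : ∀ [𝓢.metric.toPseudoRiemannianMetric.HasLeviCivita],
      𝓢.metric.toPseudoRiemannianMetric.IsRicciFlat)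
    (t : ℕ → ℝ) :
    ∃ (L : NearFramedChart (Kerr.region a r₀) (Kerr.ksFrame M a r₀)) (φ : ℕ → ℕ), StrictMono φ ∧
      (∀ y ∈ (Kerr.region a r₀ : Set E4), ‖L.G y - Kerr.bilin M a y‖ ≤ (1 + 2 * |M| / r₀) ^ 2 * θ) ∧
      (∀ (k : ℕ), ∀ K ⊆ (Kerr.region a r₀ : Set E4), IsCompact K →
        Tendsto (fun j ↦ supCkENorm K k
          (𝓢.metricInCoords ((Φ ∘ (Kerr.regionBackground M a r₀).timeShift
              (Kerr.regionBackground_timeInvariant M a r₀) (t (φ j))) ∘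
              (chartAt E4 (⟨x₀, hx₀⟩ : Kerr.region a r₀)).symm) - L.G)) atTop (𝓝 0)) ∧
      (∀ k : ℕ, SubconvergesLocallyTo (fun _ ↦ 𝓢)
        (fun n ↦ Φ ((Kerr.regionBackground M a r₀).timeShift
          (Kerr.regionBackground_timeInvariant M a r₀) (t n) ⟨x₀, hx₀⟩))
        (L.spacetime (Kerr.isConnected_region_holds a r₀)) ⟨x₀, hx₀⟩ k) ∧
      (∀ k : ℕ, SubconvergesLocallyWithFarChartsTo (fun _ ↦ 𝓢)
        (fun n ↦ Φ ((Kerr.regionBackground M a r₀).timeShift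
          (Kerr.regionBackground_timeInvariant M a r₀) (t n) ⟨x₀, hx₀⟩))
        (L.spacetime (Kerr.isConnected_region_holds a r₀)) ⟨x₀, hx₀⟩ k (Kerr.regionBackground M a r₀)
        (fun n ↦ Φ ∘ (Kerr.regionBackground M a r₀).timeShift
          (Kerr.regionBackground_timeInvariant M a r₀) (t n))
        (id : Kerr.region a r₀ → (L.spacetime (Kerr.isConnected_region_holds a r₀)).carrier)) ∧
      ∀ [(L.spacetime (Kerr.isConnected_region_holds a r₀)).metric.toPseudoRiemannianMetric.HasLeviCivita],
        (L.spacetime (Kerr.isConnected_region_holds a r₀)).metric.toPseudoRiemannianMetric.IsRicciFlat := by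
  set KB : ModelBackground := Kerr.regionBackground M a r₀ with hKB
  have hT := Kerr.regionBackground_timeInvariant M a r₀
  have hbil := Kerr.regionBackground_bilin_timeInvariant M a r₀
  let Ψ : ℕ → Kerr.region a r₀ → 𝓢.carrier := fun n ↦ Φ ∘ KB.timeShift hT (t n)
  have hΨ : ∀ n, ContMDiff 𝓘(ℝ, E4) (𝓡 4) ∞ (Ψ n) := fun n ↦ hΦ.comp (KB.contMDiff_timeShift hT (t n))
  have hΨinj : ∀ n, Injective (Ψ n) := fun n ↦ hinj.comp (KB.injective_timeShift hT (t n))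
  -- Kerr deviations of the translates are the translates of the Kerr deviation
  have hdev : ∀ n, 𝓢.deviationExtend KB (Ψ n) = fun y ↦ 𝓢.deviationExtend KB Φ (y + t n • E4.basisVector 0) :=
    fun n ↦ 𝓢.deviationExtend_comp_timeShift KB hT Φ hbil hΦ (t n)
  have hpinch' : ∀ n, ∀ y ∈ (Kerr.region a r₀ : Set E4),
      ‖𝓢.deviationExtend KB (Ψ n) y‖ ≤ θ / (1 + 2 * |M| / r₀) ^ 2 := fun n y hy ↦ by
    rw [hdev n]
    exact hpinch _ (hT _ y hy)
  have hb : ∀ (i : ℕ), ∀ K ⊆ (Kerr.region a r₀ : Set E4), IsCompact K → ∃ Λ : ℝ, ∀ n, ∀ z ∈ K,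
      ‖iteratedFDeriv ℝ i (𝓢.deviationExtend KB (Ψ n)) z‖ ≤ Λ := by
    intro i K hKO _
    obtain ⟨Λ, hΛ, hΛb⟩ := hbound i
    refine ⟨Λ.toReal, fun n z hz ↦ ?_⟩
    have hsup : supCkENorm (Kerr.region a r₀ : Set E4) i (𝓢.deviationExtend KB (Ψ n)) =
        supCkENorm (Kerr.region a r₀ : Set E4) i (𝓢.deviationExtend KB Φ) :=
      𝓢.supCkENorm_deviationExtend_comp_timeShift KB hT Φ hbil hΦ (t n) i
    have hle : supCkENorm (Kerr.region a r₀ : Set E4) i (𝓢.deviationExtend KB (Ψ n)) ≤ Λ :=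
      hsup.trans_le hΛb
    exact (norm_iteratedFDeriv_le_toReal_supCkENorm le_rfl (hKO hz) _ (ne_top_of_le_ne_top hΛ hle)).trans
      (ENNReal.toReal_mono hΛ hle)
  -- orientation of the translates at the centre: propagate the orientation of `Φ` to the translated point
  have hframed : ∀ y ∈ (Kerr.region a r₀ : Set E4),
      ‖𝓢.framedDeviation (Kerr.ksFrame M a r₀) Φ ⟨x₀, hx₀⟩ y‖ < 1 := fun y hy ↦ by
    refine ((𝓢.norm_framedDeviation_ksFrame_le hr₀ Φ hΦ ⟨x₀, hx₀⟩ hy).trans ?_).trans_lt hθ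
    have hΘ : 0 < (1 + 2 * |M| / r₀) ^ 2 := by positivity
    calc (1 + 2 * |M| / r₀) ^ 2 * ‖𝓢.deviationExtend (Kerr.regionBackground M a r₀) Φ y‖
        ≤ (1 + 2 * |M| / r₀) ^ 2 * (θ / (1 + 2 * |M| / r₀) ^ 2) := by gcongr; exact hpinch y hy
      _ = θ := by field_simp
  have hfutall : ∀ z : Kerr.region a r₀, 𝓢.timeOrientation.IsFutureDirected
      (mfderiv 𝓘(ℝ, E4) (𝓡 4) Φ z ((Kerr.ksFrame M a r₀).Ainv z (E4.basisVector 0))) :=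
    𝓢.isFutureDirected_mfderiv_Ainv_basisVector_zero_of_norm_framedDeviation_lt_one (Kerr.ksFrame M a r₀)
      (Kerr.isConnected_region_holds a r₀).isPreconnected Φ hΦ ⟨x₀, hx₀⟩ hframed hfut
  have hfut' : ∀ n, 𝓢.timeOrientation.IsFutureDirected
      (mfderiv 𝓘(ℝ, E4) (𝓡 4) (Ψ n) ⟨x₀, hx₀⟩ ((Kerr.ksFrame M a r₀).Ainv x₀ (E4.basisVector 0))) := by
    intro n
    have e1 := 𝓢.mfderiv_comp_timeShift_apply KB hT Φ hΦ (t n) ⟨x₀, hx₀⟩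
      ((Kerr.ksFrame M a r₀).Ainv x₀ (E4.basisVector 0))
    have e2 : (Kerr.ksFrame M a r₀).Ainv x₀ =
        (Kerr.ksFrame M a r₀).Ainv ((KB.timeShift hT (t n) ⟨x₀, hx₀⟩ : Kerr.region a r₀) : E4) :=
      (Kerr.ksFrameInvMap_add_smul_basisVector_zero M a x₀ (t n)).symm
    have h := hfutall (KB.timeShift hT (t n) ⟨x₀, hx₀⟩)
    rw [← e2] at h
    exact (Iff.of_eq (congrArg 𝓢.timeOrientation.IsFutureDirected e1)).2 h
  obtain ⟨L, φ, hφ, hGpinch, hconvG, hsub, hfar, hflat⟩ :=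
    exists_nearKerrChart_subconvergesLocallyTo_isRicciFlat (𝓢ₙ := fun _ ↦ 𝓢)
      (pₙ := fun n ↦ Φ (KB.timeShift hT (t n) ⟨x₀, hx₀⟩)) hr₀ hx₀ Ψ hΨ hΨinj (fun _ ↦ rfl) hfut' hθ
      hpinch' hb (fun _ ↦ hvac)
  exact ⟨L, φ, hφ, fun y hy ↦ L.norm_G_sub_kerr_le hr₀ hGpinch hy, hconvG, hsub, hfar, hflat⟩

/-- **ω-limits along time translations, no orientation hypothesis**: as
`exists_kerrOmegaLimit_timeTranslates` without assuming `dΦ(A⁻¹∂₀)` future-directed; the limit is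
time-oriented by `A⁻¹∂₀` or by `−A⁻¹∂₀`. [cite: Petersen2006, Ch. 10 §3.2] -/
theorem exists_kerrOmegaLimit_timeTranslates_unoriented (hr₀ : 0 < r₀)
    (Φ : Kerr.region a r₀ → 𝓢.carrier) (hΦ : ContMDiff 𝓘(ℝ, E4) (𝓡 4) ∞ Φ) (hinj : Injective Φ)
    {x₀ : E4} (hx₀ : x₀ ∈ (Kerr.region a r₀ : Set E4)) {θ : ℝ} (hθ : θ < 1)
    (hpinch : ∀ y ∈ (Kerr.region a r₀ : Set E4),
      ‖𝓢.deviationExtend (Kerr.regionBackground M a r₀) Φ y‖ ≤ θ / (1 + 2 * |M| / r₀) ^ 2)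
    (hbound : ∀ k : ℕ, ∃ Λ : ℝ≥0∞, Λ ≠ ⊤ ∧
      supCkENorm (Kerr.region a r₀ : Set E4) k (𝓢.deviationExtend (Kerr.regionBackground M a r₀) Φ) ≤ Λ)
    (hvac : ∀ [𝓢.metric.toPseudoRiemannianMetric.HasLeviCivita],
      𝓢.metric.toPseudoRiemannianMetric.IsRicciFlat)
    (t : ℕ → ℝ) :
    ∃ (L : NearFramedChart (Kerr.region a r₀) (Kerr.ksFrame M a r₀)) (φ : ℕ → ℕ), StrictMono φ ∧
      (∀ y ∈ (Kerr.region a r₀ : Set E4), ‖L.G y - Kerr.bilin M a y‖ ≤ (1 + 2 * |M| / r₀) ^ 2 * θ) ∧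
      (∀ (k : ℕ), ∀ K ⊆ (Kerr.region a r₀ : Set E4), IsCompact K →
        Tendsto (fun j ↦ supCkENorm K k
          (𝓢.metricInCoords ((Φ ∘ (Kerr.regionBackground M a r₀).timeShift
              (Kerr.regionBackground_timeInvariant M a r₀) (t (φ j))) ∘
              (chartAt E4 (⟨x₀, hx₀⟩ : Kerr.region a r₀)).symm) - L.G)) atTop (𝓝 0)) ∧
      ((∀ k : ℕ, SubconvergesLocallyTo (fun _ ↦ 𝓢)
          (fun n ↦ Φ ((Kerr.regionBackground M a r₀).timeShift
            (Kerr.regionBackground_timeInvariant M a r₀) (t n) ⟨x₀, hx₀⟩))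
          (L.spacetime (Kerr.isConnected_region_holds a r₀)) ⟨x₀, hx₀⟩ k) ∨
        (∀ k : ℕ, SubconvergesLocallyTo (fun _ ↦ 𝓢)
          (fun n ↦ Φ ((Kerr.regionBackground M a r₀).timeShift
            (Kerr.regionBackground_timeInvariant M a r₀) (t n) ⟨x₀, hx₀⟩))
          (L.spacetime (Kerr.isConnected_region_holds a r₀)).reverse ⟨x₀, hx₀⟩ k)) ∧
      ∀ [(L.spacetime (Kerr.isConnected_region_holds a r₀)).metric.toPseudoRiemannianMetric.HasLeviCivita],
        (L.spacetime (Kerr.isConnected_region_holds a r₀)).metric.toPseudoRiemannianMetric.IsRicciFlat := by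
  set KB : ModelBackground := Kerr.regionBackground M a r₀ with hKB
  have hT := Kerr.regionBackground_timeInvariant M a r₀
  have hbil := Kerr.regionBackground_bilin_timeInvariant M a r₀
  let Ψ : ℕ → Kerr.region a r₀ → 𝓢.carrier := fun n ↦ Φ ∘ KB.timeShift hT (t n)
  have hΨ : ∀ n, ContMDiff 𝓘(ℝ, E4) (𝓡 4) ∞ (Ψ n) := fun n ↦ hΦ.comp (KB.contMDiff_timeShift hT (t n))
  have hΨinj : ∀ n, Injective (Ψ n) := fun n ↦ hinj.comp (KB.injective_timeShift hT (t n))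
  have hdev : ∀ n, 𝓢.deviationExtend KB (Ψ n) = fun y ↦ 𝓢.deviationExtend KB Φ (y + t n • E4.basisVector 0) :=
    fun n ↦ 𝓢.deviationExtend_comp_timeShift KB hT Φ hbil hΦ (t n)
  have hpinch' : ∀ n, ∀ y ∈ (Kerr.region a r₀ : Set E4),
      ‖𝓢.deviationExtend KB (Ψ n) y‖ ≤ θ / (1 + 2 * |M| / r₀) ^ 2 := fun n y hy ↦ by
    rw [hdev n]
    exact hpinch _ (hT _ y hy)
  have hb : ∀ (i : ℕ), ∀ K ⊆ (Kerr.region a r₀ : Set E4), IsCompact K → ∃ Λ : ℝ, ∀ n, ∀ z ∈ K,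
      ‖iteratedFDeriv ℝ i (𝓢.deviationExtend KB (Ψ n)) z‖ ≤ Λ := by
    intro i K hKO _
    obtain ⟨Λ, hΛ, hΛb⟩ := hbound i
    refine ⟨Λ.toReal, fun n z hz ↦ ?_⟩
    have hle : supCkENorm (Kerr.region a r₀ : Set E4) i (𝓢.deviationExtend KB (Ψ n)) ≤ Λ :=
      (𝓢.supCkENorm_deviationExtend_comp_timeShift KB hT Φ hbil hΦ (t n) i).trans_le hΛb
    exact (norm_iteratedFDeriv_le_toReal_supCkENorm le_rfl (hKO hz) _ (ne_top_of_le_ne_top hΛ hle)).trans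
      (ENNReal.toReal_mono hΛ hle)
  obtain ⟨L, φ, hφ, hGpinch, hconvG, hsub, hflat⟩ :=
    exists_nearKerrChart_subconvergesLocallyTo_unoriented_isRicciFlat (𝓢ₙ := fun _ ↦ 𝓢)
      (pₙ := fun n ↦ Φ (KB.timeShift hT (t n) ⟨x₀, hx₀⟩)) hr₀ hx₀ Ψ hΨ hΨinj (fun _ ↦ rfl) hθ
      hpinch' hb (fun _ ↦ hvac)
  exact ⟨L, φ, hφ, fun y hy ↦ L.norm_G_sub_kerr_le hr₀ hGpinch hy, hconvG, hsub, hflat⟩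

end Spacetime


end Literature.Geometry.Lorentzian

end
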